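import Mathlib.Data.Real.Basic
import Mathlib.Tactic.Positivity
import Mathlib.Tactic.Linarith
import Mathlib.Tactic.Ring
import HarnessLib

/-!
# QUANT lane R8, T-DEC: the capacity / torque-cost inequalities of the three-2-chains certificate — PART C (arm-1 gen 55, architect)

builds on p205010 (kernel theorem, internal audit signed; external expert review pending)

Support file (`--supports stmt-CriticalPhenomena-4575`), QUANT lane seat prim-quant-arm-1 (gen 55, architect); memo
`run/shared/lean/prim/quant/prim-quant-arm-1-g55/ARCH-G55.md` §3.  Theorems only, standard axioms, no sorries, no definitions (the six atom
polynomials are file-local notation `tA1[…] … tA6[…]`, restated identically in every part and in the assembly `…QuantTripleTwoChain`).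
For three independent `{0,1,2}`-valued counts with laws `(aᵢ, bᵢ, cᵢ)` (`bᵢ = 1 − aᵢ − cᵢ`; the 2-chain `R[qᵢ](R[pᵢ])` has `aᵢ = 1 − qᵢ`,
`bᵢ = qᵢ(1 − pᵢ)`, `cᵢ = qᵢpᵢ`) the atoms of the sum are `f_h = [Xʰ] Πᵢ(aᵢ + bᵢX + cᵢX²)` and the mean is `s = Σ(bᵢ + 2cᵢ)`.  The torque
certificate of `…QuantTripleTwoChain` (regimes of the gated mean `T = a·s ≤ s`; transports `…QuantTorqueSplitRoutes` / `…QuantTorqueHallB`)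
needs eleven inequalities, linear in the atoms and polynomial in `T`, on `{aᵢ, bᵢ, cᵢ ≥ 0, lo ≤ T ≤ up, T ≤ s}`; each is proved by an EXACT
Handelman certificate `P = Σ_j λ_j·Π(generators)`, `λ_j ∈ ℚ_{≥0}`, generators `aᵢ, bᵢ, cᵢ, T − lo, up − T, s − T`, found by LP on kit
(jobs j274605 / j274885 / j275973, code `run/shared/lean/prim/quant/prim-quant-arm-1-g55/kit-cert/`) and re-solved exactly over `ℚ`; Lean
checks the sign by `positivity` on abstract nonnegative generators and the identity by `ring`.  This part: `tcIneq_costUWlo`, `tcIneq_costUplo`, `tcIneq_costUphi`, `tcIneq_costUWhilin`.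

HONEST STATUS.  Elementary polynomial inequalities (certificate-backed); `SiblingStep`, `GateStepN`, `LightResidDECOracle`, `FarTreeRow` OPEN;
RATE class (log\*) / honest sentence of `run/shared/lean/prim/quant/README.md` unchanged.  [this work].  Nothing here is cited as a published
result (Handelman's Positivstellensatz is the search heuristic, not an ingredient of the proofs).  The gluing rows served
[cite: KozmaNitzan2024, Conjecture 3 (p. 15)]; product measure [cite: Grimmett1999, §1.3 p. 10].
-/

noncomputable section

namespace Summit.CriticalPhenomena.PercolationContinuityZ3.Theorems
namespace Quant
namespace LawDec

/-! ### The atoms of three independent `{0,1,2}`-valued counts (file-local notation; `f_h = [Xʰ]Π(aᵢ + bᵢX + cᵢX²)`) -/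

/-- `f₁ = Σ bᵢ aⱼ aₖ` -/
local notation3 "tA1[" a₁ ", " b₁ ", " a₂ ", " b₂ ", " a₃ ", " b₃ "]" => (b₁ * a₂ * a₃ + a₁ * b₂ * a₃ + a₁ * a₂ * b₃ : ℝ)
/-- `f₂ = Σ cᵢ aⱼ aₖ + Σ bᵢ bⱼ aₖ` -/
local notation3 "tA2[" a₁ ", " b₁ ", " c₁ ", " a₂ ", " b₂ ", " c₂ ", " a₃ ", " b₃ ", " c₃ "]" =>
  (c₁ * a₂ * a₃ + a₁ * c₂ * a₃ + a₁ * a₂ * c₃ + b₁ * b₂ * a₃ + b₁ * a₂ * b₃ + a₁ * b₂ * b₃ : ℝ)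
/-- `f₃ = b₁b₂b₃ + Σ cᵢ bⱼ aₖ` -/
local notation3 "tA3[" a₁ ", " b₁ ", " c₁ ", " a₂ ", " b₂ ", " c₂ ", " a₃ ", " b₃ ", " c₃ "]" =>
  (b₁ * b₂ * b₃ + c₁ * b₂ * a₃ + c₁ * a₂ * b₃ + b₁ * c₂ * a₃ + a₁ * c₂ * b₃ + b₁ * a₂ * c₃ + a₁ * b₂ * c₃ : ℝ)
/-- `f₄ = Σ aᵢ cⱼ cₖ + Σ cᵢ bⱼ bₖ` -/
local notation3 "tA4[" a₁ ", " b₁ ", " c₁ ", " a₂ ", " b₂ ", " c₂ ", " a₃ ", " b₃ ", " c₃ "]" =>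
  (c₁ * c₂ * a₃ + c₁ * a₂ * c₃ + a₁ * c₂ * c₃ + c₁ * b₂ * b₃ + b₁ * c₂ * b₃ + b₁ * b₂ * c₃ : ℝ)
/-- `f₅ = Σ bᵢ cⱼ cₖ` -/
local notation3 "tA5[" b₁ ", " c₁ ", " b₂ ", " c₂ ", " b₃ ", " c₃ "]" => (b₁ * c₂ * c₃ + c₁ * b₂ * c₃ + c₁ * c₂ * b₃ : ℝ)
/-- `f₆ = c₁c₂c₃` -/
local notation3 "tA6[" c₁ ", " c₂ ", " c₃ "]" => (c₁ * c₂ * c₃ : ℝ)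

/-! ### Certificates -/

set_option maxHeartbeats 4000000 in
set_option maxRecDepth 4096 in
/-- **regime `4 ≤ T ≤ 24/5`, joint torque cost `U + 2V ≤ R′`: `T·f₁ − (6−T)f₅ + 2T·f₂ ≤ 3T·f₃ + 2T·f₄`** — for every triple of laws `(aᵢ, bᵢ, cᵢ)` on `{0,1,2}` with `T ≤ s = Σ(bᵢ + 2cᵢ)`.  Exact Handelman certificate of
degree 4 (117 products of the generators `aᵢ, bᵢ, cᵢ, T − 4, 24 / 5 − T, s − T`; kit j274885): the sign by `positivity` on
abstract nonnegative generators, the identity by `ring`. [this work] -/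
theorem tcIneq_costUWlo (a₁ c₁ a₂ c₂ a₃ c₃ T : ℝ) (ha₁ : 0 ≤ a₁) (hc₁ : 0 ≤ c₁) (hb₁ : 0 ≤ 1 - a₁ - c₁) (ha₂ : 0 ≤ a₂) (hc₂ : 0 ≤ c₂)
    (hb₂ : 0 ≤ 1 - a₂ - c₂) (ha₃ : 0 ≤ a₃) (hc₃ : 0 ≤ c₃) (hb₃ : 0 ≤ 1 - a₃ - c₃)
    (hTlo : (4 : ℝ) ≤ T) (hTup : T ≤ 24 / 5) (hTs : T ≤ 1 - a₁ + c₁ + (1 - a₂ + c₂) + (1 - a₃ + c₃)) :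
    0 ≤ 3 * T * tA3[a₁, (1 - a₁ - c₁), c₁, a₂, (1 - a₂ - c₂), c₂, a₃, (1 - a₃ - c₃), c₃] + 2 * T * tA4[a₁, (1 - a₁ - c₁), c₁, a₂, (1 - a₂ - c₂), c₂, a₃, (1 - a₃ - c₃), c₃] + (6 - T) * tA5[(1 - a₁ - c₁), c₁, (1 - a₂ - c₂), c₂, (1 - a₃ - c₃), c₃] - T * tA1[a₁, (1 - a₁ - c₁), a₂, (1 - a₂ - c₂), a₃, (1 - a₃ - c₃)] - 2 * T * tA2[a₁, (1 - a₁ - c₁), c₁, a₂, (1 - a₂ - c₂), c₂, a₃, (1 - a₃ - c₃), c₃] := by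
  have main : ∀ (b₁ b₂ b₃ g₁ g₂ g₃ : ℝ), 0 ≤ b₁ → 0 ≤ b₂ → 0 ≤ b₃ → 0 ≤ g₁ → 0 ≤ g₂ → 0 ≤ g₃ →
      b₁ = 1 - a₁ - c₁ → b₂ = 1 - a₂ - c₂ → b₃ = 1 - a₃ - c₃ → g₁ = T - 4 → g₂ = 24 / 5 - T →
      g₃ = 1 - a₁ + c₁ + (1 - a₂ + c₂) + (1 - a₃ + c₃) - T →
      0 ≤ 3 * T * tA3[a₁, (1 - a₁ - c₁), c₁, a₂, (1 - a₂ - c₂), c₂, a₃, (1 - a₃ - c₃), c₃] + 2 * T * tA4[a₁, (1 - a₁ - c₁), c₁, a₂, (1 - a₂ - c₂), c₂, a₃, (1 - a₃ - c₃), c₃] + (6 - T) * tA5[(1 - a₁ - c₁), c₁, (1 - a₂ - c₂), c₂, (1 - a₃ - c₃), c₃] - T * tA1[a₁, (1 - a₁ - c₁), a₂, (1 - a₂ - c₂), a₃, (1 - a₃ - c₃)] - 2 * T * tA2[a₁, (1 - a₁ - c₁), c₁, a₂, (1 - a₂ - c₂), c₂, a₃, (1 - a₃ - c₃), c₃] :=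 by
    intro b₁ b₂ b₃ g₁ g₂ g₃ hb₁' hb₂' hb₃' hg₁ hg₂ hg₃ e₁ e₂ e₃ e₄ e₅ e₆
    have hpos : 0 ≤ ((((((4 : ℝ) / 5 * a₁ * b₁ + (2 : ℝ) / 5 * g₁ * a₁ + (8 : ℝ) / 5 * a₁ * g₃ + (1 : ℝ) / 5 * g₁ * b₁)
          + (((4 : ℝ) / 5 * a₂ * b₂ + (2 : ℝ) / 5 * g₁ * a₂ + (8 : ℝ) / 5 * a₂ * g₃ + (1 : ℝ) / 5 * g₁ * b₂)
          + ((4 : ℝ) / 5 * a₃ * b₃ + (8 : ℝ) / 5 * g₁ * a₃ + (8 : ℝ) / 5 * a₃ * g₃ + (7 : ℝ) / 5 * g₁ * b₃)))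
          + ((((4 : ℝ) / 5 * a₁ * b₁ * c₃ + (72 : ℝ) / 5 * a₁ * a₂ * a₃ + (24 : ℝ) / 5 * a₁ * a₂ * b₃ + (4 : ℝ) / 5 * a₁ * b₂ * c₂)
          + ((81 : ℝ) / 25 * a₁ * b₃ * c₂ + (24 : ℝ) / 5 * a₁ * a₃ * b₂ + (5 : ℝ) * a₁ * b₂ * c₃ + (4 : ℝ) / 5 * a₁ * b₃ * c₃))
          + (((6 : ℝ) / 5 * g₁ * a₁ * c₃ + (1 : ℝ) * b₂ * c₁ ^ 2 + (1 : ℝ) / 25 * b₃ * c₁ ^ 2 + (4 : ℝ) / 5 * a₂ * b₁ * c₁)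
          + ((4 : ℝ) / 5 * a₃ * b₁ * c₁ + (101 : ℝ) / 25 * a₂ * b₃ * c₁ + (101 : ℝ) / 25 * a₃ * b₂ * c₁ + (2 : ℝ) / 25 * b₂ * b₃ * c₁))))
          + (((((24 : ℝ) / 5 * a₂ * a₃ * b₁ + (21 : ℝ) / 5 * a₂ * b₁ * c₃ + (1 : ℝ) * b₁ * c₂ ^ 2 + (101 : ℝ) / 25 * a₃ * b₁ * c₂)
          + ((2 : ℝ) / 25 * b₁ * b₃ * c₂ + (2 : ℝ) * b₁ * b₂ * c₃ + (84 : ℝ) / 5 * b₁ * b₂ * b₃ + (1 : ℝ) * b₁ * b₂ * g₃))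
          + (((1 : ℝ) / 25 * b₁ * c₃ ^ 2 + (1 : ℝ) / 25 * b₁ * b₃ * g₃ + (4 : ℝ) / 5 * a₂ * b₃ * c₃ + (1 : ℝ) / 25 * b₃ * c₂ ^ 2)
          + ((4 : ℝ) / 5 * a₃ * b₂ * c₂ + (4 : ℝ) / 5 * a₃ * b₃ * c₂ + (1 : ℝ) / 25 * b₂ * c₃ ^ 2 + (1 : ℝ) / 25 * b₂ * b₃ * g₃)))
          + ((((8 : ℝ) / 5 * a₁ ^ 2 * a₂ * a₃ + (8 : ℝ) * a₁ ^ 2 * c₂ * c₃ + (79 : ℝ) / 25 * a₁ ^ 2 * b₃ * c₂ + (11 : ℝ) / 5 * a₁ ^ 2 * b₂ * c₃)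
          + ((12 : ℝ) / 5 * a₁ * b₁ * c₂ * c₃ + (4 : ℝ) / 5 * a₁ * b₁ * b₃ * c₂ + (8 : ℝ) / 5 * a₁ * a₂ ^ 2 * a₃ + (8 : ℝ) / 5 * a₁ * a₂ * a₃ ^ 2))
          + (((12 : ℝ) / 5 * g₁ * a₁ * a₂ * a₃ + (4 : ℝ) / 5 * a₁ * a₂ * c₃ * g₃ + (4 : ℝ) / 5 * a₁ * a₂ * b₃ ^ 2 + (79 : ℝ) / 25 * a₁ * b₃ * c₂ ^ 2)
          + ((24 : ℝ) / 5 * a₁ * b₂ * c₂ * c₃ + (4 : ℝ) / 5 * a₁ * a₃ * c₂ * g₃ + (28 : ℝ) / 5 * a₁ * b₃ * c₂ * c₃ + (22 : ℝ) / 5 * g₁ * a₁ * c₂ * c₃)))))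
          + (((((12 : ℝ) / 5 * a₁ * c₂ * c₃ * g₃ + (4 : ℝ) * a₁ * b₃ ^ 2 * c₂ + (14 : ℝ) / 5 * g₁ * a₁ * b₃ * c₂ + (4 : ℝ) / 5 * a₁ * a₃ * b₂ ^ 2)
          + (((16 : ℝ) / 5 * a₁ * b₂ ^ 2 * c₃ + (79 : ℝ) / 25 * a₁ * b₂ * c₃ ^ 2 + (14 : ℝ) / 5 * g₁ * a₁ * b₂ * c₃ + (59 : ℝ) / 25 * a₁ * b₂ * b₃ * g₃)
          + ((79 : ℝ) / 25 * a₂ * b₃ * c₁ ^ 2 + (11 : ℝ) / 5 * a₃ * b₂ * c₁ ^ 2 + (172 : ℝ) / 25 * b₂ * b₃ * c₁ ^ 2 + (28 : ℝ) / 5 * a₂ * b₁ * c₁ * c₃)))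
          + ((((24 : ℝ) / 5 * a₃ * b₁ * c₁ * c₂ + (79 : ℝ) / 25 * b₁ * b₂ * b₃ * c₁ + (8 : ℝ) * a₂ ^ 2 * c₁ * c₃ + (79 : ℝ) / 25 * a₂ ^ 2 * b₃ * c₁)
          + ((16 : ℝ) / 5 * a₂ * b₂ * c₁ * c₃ + (4 : ℝ) / 5 * a₂ * b₂ * b₃ * c₁ + (4 : ℝ) / 5 * a₂ * a₃ * c₁ * g₃ + (24 : ℝ) / 5 * a₂ * b₃ * c₁ * c₃))
          + (((28 : ℝ) / 5 * g₁ * a₂ * c₁ * c₃ + (12 : ℝ) / 5 * a₂ * c₁ * c₃ * g₃ + (16 : ℝ) / 5 * a₂ * b₃ ^ 2 * c₁ + (14 : ℝ) / 5 * g₁ * a₂ * b₃ * c₁)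
          + ((24 : ℝ) / 5 * a₃ * b₂ * c₁ * c₂ + (8 : ℝ) * a₃ ^ 2 * c₁ * c₂ + (12 : ℝ) / 5 * a₃ * b₃ * c₁ * c₂ + (22 : ℝ) / 5 * g₁ * a₃ * c₁ * c₂))))
          + (((((12 : ℝ) / 5 * a₃ * c₁ * c₂ * g₃ + (12 : ℝ) / 5 * g₂ * b₃ * c₁ * c₂ + (16 : ℝ) / 5 * a₃ * b₂ ^ 2 * c₁ + (79 : ℝ) / 25 * a₃ ^ 2 * b₂ * c₁)
          + ((4 : ℝ) / 5 * a₃ * b₂ * b₃ * c₁ + (14 : ℝ) / 5 * g₁ * a₃ * b₂ * c₁ + (6 : ℝ) / 5 * g₂ * b₂ * c₁ * c₃ + (11 : ℝ) / 25 * g₁ * b₂ * b₃ * c₁))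
          + (((4 : ℝ) / 5 * a₂ * a₃ * b₁ ^ 2 + (4 : ℝ) * a₂ * b₁ ^ 2 * c₃ + (16 : ℝ) / 5 * a₃ * b₁ ^ 2 * c₂ + (11 : ℝ) / 5 * a₂ ^ 2 * b₁ * c₃)
          + ((4 : ℝ) / 5 * a₂ * b₁ * b₂ * c₃ + (79 : ℝ) / 25 * a₂ * b₁ * c₃ ^ 2 + (4 : ℝ) * g₁ * a₂ * b₁ * c₃ + (59 : ℝ) / 25 * a₂ * b₁ * b₃ * g₃)))
          + ((((11 : ℝ) / 5 * a₃ * b₁ * c₂ ^ 2 + (172 : ℝ) / 25 * b₁ * b₃ * c₂ ^ 2 + (79 : ℝ) / 25 * b₁ * b₂ * b₃ * c₂ + (79 : ℝ) / 25 * a₃ ^ 2 * b₁ * c₂)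
          + ((14 : ℝ) / 5 * g₁ * a₃ * b₁ * c₂ + (6 : ℝ) / 5 * g₂ * b₁ * c₂ * c₃ + (11 : ℝ) / 25 * g₁ * b₁ * b₃ * c₂ + (7 : ℝ) / 5 * a₃ * b₁ * b₂ * g₃))
          + (((148 : ℝ) / 25 * b₁ * b₂ * c₃ ^ 2 + (11 : ℝ) / 5 * b₁ * b₂ * b₃ * c₃ + (13 : ℝ) / 5 * g₁ * b₁ * b₂ * c₃ + (6 : ℝ) * g₁ * b₁ * b₂ * b₃)
          + ((93 : ℝ) / 25 * b₁ * b₂ * b₃ * g₃)))))) := by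
      positivity
    subst e₁ e₂ e₃ e₄ e₅ e₆
    convert hpos using 1
    ring
  exact main _ _ _ _ _ _ hb₁ hb₂ hb₃ (sub_nonneg.mpr hTlo) (sub_nonneg.mpr hTup) (sub_nonneg.mpr hTs) rfl rfl rfl rfl rfl rfl

set_option maxHeartbeats 4000000 in
set_option maxRecDepth 4096 in
/-- **regime `4 ≤ T ≤ 24/5`, torque cost `U ≤ R′`: `T·f₁ − (6−T)f₅ ≤ (5T−12)f₃ + (4T−12)f₄`** — for every triple of laws `(aᵢ, bᵢ, cᵢ)` on `{0,1,2}` with `T ≤ s = Σ(bᵢ + 2cᵢ)`.  Exact Handelman certificate of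
degree 4 (76 products of the generators `aᵢ, bᵢ, cᵢ, T − 4, 24 / 5 − T, s − T`; kit j276081): the sign by `positivity` on
abstract nonnegative generators, the identity by `ring`. [this work] -/
theorem tcIneq_costUplo (a₁ c₁ a₂ c₂ a₃ c₃ T : ℝ) (ha₁ : 0 ≤ a₁) (hc₁ : 0 ≤ c₁) (hb₁ : 0 ≤ 1 - a₁ - c₁) (ha₂ : 0 ≤ a₂) (hc₂ : 0 ≤ c₂)
    (hb₂ : 0 ≤ 1 - a₂ - c₂) (ha₃ : 0 ≤ a₃) (hc₃ : 0 ≤ c₃) (hb₃ : 0 ≤ 1 - a₃ - c₃)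
    (hTlo : (4 : ℝ) ≤ T) (hTup : T ≤ 24 / 5) (hTs : T ≤ 1 - a₁ + c₁ + (1 - a₂ + c₂) + (1 - a₃ + c₃)) :
    0 ≤ (5 * T - 12) * tA3[a₁, (1 - a₁ - c₁), c₁, a₂, (1 - a₂ - c₂), c₂, a₃, (1 - a₃ - c₃), c₃] + (4 * T - 12) * tA4[a₁, (1 - a₁ - c₁), c₁, a₂, (1 - a₂ - c₂), c₂, a₃, (1 - a₃ - c₃), c₃] + (6 - T) * tA5[(1 - a₁ - c₁), c₁, (1 - a₂ - c₂), c₂, (1 - a₃ - c₃), c₃] - T * tA1[a₁, (1 - a₁ - c₁), a₂, (1 - a₂ - c₂), a₃, (1 - a₃ - c₃)] := by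
  have main : ∀ (b₁ b₂ b₃ g₁ g₂ g₃ : ℝ), 0 ≤ b₁ → 0 ≤ b₂ → 0 ≤ b₃ → 0 ≤ g₁ → 0 ≤ g₂ → 0 ≤ g₃ →
      b₁ = 1 - a₁ - c₁ → b₂ = 1 - a₂ - c₂ → b₃ = 1 - a₃ - c₃ → g₁ = T - 4 → g₂ = 24 / 5 - T →
      g₃ = 1 - a₁ + c₁ + (1 - a₂ + c₂) + (1 - a₃ + c₃) - T →
      0 ≤ (5 * T - 12) * tA3[a₁, (1 - a₁ - c₁), c₁, a₂, (1 - a₂ - c₂), c₂, a₃, (1 - a₃ - c₃), c₃] + (4 * T - 12) * tA4[a₁, (1 - a₁ - c₁), c₁, a₂, (1 - a₂ - c₂), c₂, a₃, (1 - a₃ - c₃), c₃] + (6 - T) * tA5[(1 - a₁ - c₁), c₁, (1 - a₂ - c₂), c₂, (1 - a₃ - c₃), c₃] - T * tA1[a₁, (1 - a₁ - c₁), a₂, (1 - a₂ - c₂), a₃, (1 - a₃ - c₃)] := by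
    intro b₁ b₂ b₃ g₁ g₂ g₃ hb₁' hb₂' hb₃' hg₁ hg₂ hg₃ e₁ e₂ e₃ e₄ e₅ e₆
    have hpos : 0 ≤ ((((((1 : ℝ) * a₁ ^ 2 + (3 : ℝ) / 5 * a₁ * b₁ + (1 : ℝ) / 2 * g₁ * a₁ + (3 : ℝ) / 5 * a₁ * g₃)
          + ((9 : ℝ) / 5 * b₁ * b₂ + (2 : ℝ) * b₁ * b₃ + (8 : ℝ) / 5 * a₂ ^ 2 + (1 : ℝ) * a₂ * b₂))
          + (((7 : ℝ) / 10 * g₁ * a₂ + (1 : ℝ) * a₂ * g₃ + (11 : ℝ) / 5 * b₂ * b₃ + (11 : ℝ) / 5 * a₃ ^ 2)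
          + ((7 : ℝ) / 5 * a₃ * b₃ + (9 : ℝ) / 10 * g₁ * a₃ + (7 : ℝ) / 5 * a₃ * g₃ + (1 : ℝ) / 5 * a₁ ^ 2 * c₂)))
          + ((((36 : ℝ) / 5 * a₁ * a₂ * a₃ + (2 : ℝ) / 5 * a₁ * c₂ ^ 2 + (2 : ℝ) * a₁ * c₂ * c₃ + (7 : ℝ) * a₁ * b₃ * c₂)
          + ((37 : ℝ) / 5 * a₁ * b₂ * c₃ + (2 : ℝ) / 5 * a₁ * b₂ * g₃ + (2 : ℝ) / 5 * a₁ * c₃ ^ 2 + (2 : ℝ) / 5 * g₁ * a₁ * c₃))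
          + (((2 : ℝ) / 5 * a₁ * b₃ * g₃ + (1 : ℝ) / 5 * a₂ * c₁ ^ 2 + (1 : ℝ) * b₂ * c₁ ^ 2 + (4 : ℝ) / 5 * b₃ * c₁ ^ 2)
          + (((2 : ℝ) / 5 * b₁ * b₂ * c₁ + (2 : ℝ) / 5 * b₁ * b₃ * c₁ + (2 : ℝ) / 5 * a₂ ^ 2 * c₁ + (8 : ℝ) / 5 * a₂ * c₁ * c₃)
          + ((31 : ℝ) / 5 * a₂ * b₃ * c₁ + (6 : ℝ) / 5 * a₃ * c₁ * c₂ + (29 : ℝ) / 5 * a₃ * b₂ * c₁ + (2 : ℝ) / 5 * a₃ ^ 2 * c₁)))))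
          + (((((4 : ℝ) / 5 * g₁ * a₃ * c₁ + (7 : ℝ) * a₂ * b₁ * c₃ + (1 : ℝ) / 5 * a₂ * b₁ * g₃ + (4 : ℝ) / 5 * b₁ * c₂ ^ 2)
          + ((1 : ℝ) / 5 * b₁ * b₂ * c₂ + (31 : ℝ) / 5 * a₃ * b₁ * c₂ + (4 : ℝ) / 5 * b₁ * b₃ * c₂ + (8 : ℝ) / 5 * b₁ * b₂ * c₃))
          + (((16 : ℝ) / 5 * b₁ * b₂ * b₃ + (11 : ℝ) / 10 * g₁ * b₁ * b₂ + (3 : ℝ) / 5 * b₁ * b₂ * g₃ + (2 : ℝ) / 5 * b₁ * c₃ ^ 2)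
          + (((11 : ℝ) / 10 * g₁ * b₁ * b₃ + (2 : ℝ) / 5 * b₁ * b₃ * g₃ + (1 : ℝ) / 5 * a₂ * c₃ ^ 2 + (1 : ℝ) / 5 * a₂ * b₃ * g₃)
          + ((2 : ℝ) / 5 * b₃ * c₂ ^ 2 + (1 : ℝ) / 5 * b₂ * b₃ * c₂ + (1 : ℝ) / 5 * a₃ ^ 2 * c₂ + (3 : ℝ) / 5 * g₁ * a₃ * c₂))))
          + ((((1 : ℝ) / 5 * b₂ * c₃ ^ 2 + (11 : ℝ) / 10 * g₁ * b₂ * b₃ + (1 : ℝ) / 5 * b₂ * b₃ * g₃ + (9 : ℝ) / 10 * g₁ * a₁ * a₂ * a₃)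
          + ((37 : ℝ) / 10 * g₁ * a₁ * c₂ * c₃ + (11 : ℝ) / 2 * g₁ * a₁ * b₃ * c₂ + (51 : ℝ) / 10 * g₁ * a₁ * b₂ * c₃ + (43 : ℝ) / 10 * g₁ * a₂ * c₁ * c₃))
          + (((11 : ℝ) / 2 * g₁ * a₂ * b₃ * c₁ + (31 : ℝ) / 10 * g₁ * a₃ * c₁ * c₂ + (1 : ℝ) * g₂ * b₃ * c₁ * c₂ + (47 : ℝ) / 10 * g₁ * a₃ * b₂ * c₁)
          + (((1 : ℝ) * g₂ * b₂ * c₁ * c₃ + (31 : ℝ) / 10 * g₁ * b₂ * b₃ * c₁ + (11 : ℝ) / 2 * g₁ * a₂ * b₁ * c₃ + (49 : ℝ) / 10 * g₁ * a₃ * b₁ * c₂)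
          + ((1 : ℝ) * g₂ * b₁ * c₂ * c₃ + (33 : ℝ) / 10 * g₁ * b₁ * b₃ * c₂ + (7 : ℝ) / 2 * g₁ * b₁ * b₂ * c₃ + (29 : ℝ) / 10 * g₁ * b₁ * b₂ * b₃)))))) := by
      positivity
    subst e₁ e₂ e₃ e₄ e₅ e₆
    convert hpos using 1
    ring
  exact main _ _ _ _ _ _ hb₁ hb₂ hb₃ (sub_nonneg.mpr hTlo) (sub_nonneg.mpr hTup) (sub_nonneg.mpr hTs) rfl rfl rfl rfl rfl rfl

set_option maxHeartbeats 4000000 in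
set_option maxRecDepth 4096 in
/-- **regime `24/5 ≤ T ≤ 6`, torque cost `U ≤ R′` (linearised, `T − 3 ≥ 9/5`): `T·f₁ − (6−T)f₅ ≤ (9/5)T·f₃ + (4T−12)f₄`** — for every triple of laws `(aᵢ, bᵢ, cᵢ)` on `{0,1,2}` with `T ≤ s = Σ(bᵢ + 2cᵢ)`.  Exact Handelman certificate of
degree 4 (55 products of the generators `aᵢ, bᵢ, cᵢ, T − 24 / 5, 6 − T, s − T`; kit j276081): the sign by `positivity` on
abstract nonnegative generators, the identity by `ring`. [this work] -/
theorem tcIneq_costUphi (a₁ c₁ a₂ c₂ a₃ c₃ T : ℝ) (ha₁ : 0 ≤ a₁) (hc₁ : 0 ≤ c₁) (hb₁ : 0 ≤ 1 - a₁ - c₁) (ha₂ : 0 ≤ a₂) (hc₂ : 0 ≤ c₂)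
    (hb₂ : 0 ≤ 1 - a₂ - c₂) (ha₃ : 0 ≤ a₃) (hc₃ : 0 ≤ c₃) (hb₃ : 0 ≤ 1 - a₃ - c₃)
    (hTlo : (24 / 5 : ℝ) ≤ T) (hTup : T ≤ 6) (hTs : T ≤ 1 - a₁ + c₁ + (1 - a₂ + c₂) + (1 - a₃ + c₃)) :
    0 ≤ 9 / 5 * T * tA3[a₁, (1 - a₁ - c₁), c₁, a₂, (1 - a₂ - c₂), c₂, a₃, (1 - a₃ - c₃), c₃] + (4 * T - 12) * tA4[a₁, (1 - a₁ - c₁), c₁, a₂, (1 - a₂ - c₂), c₂, a₃, (1 - a₃ - c₃), c₃] + (6 - T) * tA5[(1 - a₁ - c₁), c₁, (1 - a₂ - c₂), c₂, (1 - a₃ - c₃), c₃] - T * tA1[a₁, (1 - a₁ - c₁), a₂, (1 - a₂ - c₂), a₃, (1 - a₃ - c₃)] := by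
  have main : ∀ (b₁ b₂ b₃ g₁ g₂ g₃ : ℝ), 0 ≤ b₁ → 0 ≤ b₂ → 0 ≤ b₃ → 0 ≤ g₁ → 0 ≤ g₂ → 0 ≤ g₃ →
      b₁ = 1 - a₁ - c₁ → b₂ = 1 - a₂ - c₂ → b₃ = 1 - a₃ - c₃ → g₁ = T - 24 / 5 → g₂ = 6 - T →
      g₃ = 1 - a₁ + c₁ + (1 - a₂ + c₂) + (1 - a₃ + c₃) - T →
      0 ≤ 9 / 5 * T * tA3[a₁, (1 - a₁ - c₁), c₁, a₂, (1 - a₂ - c₂), c₂, a₃, (1 - a₃ - c₃), c₃] + (4 * T - 12) * tA4[a₁, (1 - a₁ - c₁), c₁, a₂, (1 - a₂ - c₂), c₂, a₃, (1 - a₃ - c₃), c₃] + (6 - T) * tA5[(1 - a₁ - c₁), c₁, (1 - a₂ - c₂), c₂, (1 - a₃ - c₃), c₃] - T * tA1[a₁, (1 - a₁ - c₁), a₂, (1 - a₂ - c₂), a₃, (1 - a₃ - c₃)] := by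
    intro b₁ b₂ b₃ g₁ g₂ g₃ hb₁' hb₂' hb₃' hg₁ hg₂ hg₃ e₁ e₂ e₃ e₄ e₅ e₆
    have hpos : 0 ≤ (((((8 : ℝ) / 3 * a₁ ^ 2 + (4 : ℝ) / 3 * a₁ * b₁ + (32 : ℝ) / 15 * a₁ * c₃ + (5 : ℝ) / 6 * g₁ * a₁)
          + (((4 : ℝ) / 3 * a₁ * g₃ + (32 : ℝ) / 15 * a₃ * c₁ + (16 : ℝ) / 15 * b₁ * b₂ + (16 : ℝ) / 15 * b₁ * b₃)
          + ((8 : ℝ) / 3 * a₂ ^ 2 + (4 : ℝ) / 3 * a₂ * b₂ + (5 : ℝ) / 6 * g₁ * a₂ + (4 : ℝ) / 3 * a₂ * g₃)))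
          + ((((32 : ℝ) / 15 * a₃ * c₂ + (16 : ℝ) / 15 * b₂ * b₃ + (8 : ℝ) / 3 * a₃ ^ 2 + (4 : ℝ) / 3 * a₃ * b₃)
          + ((5 : ℝ) / 6 * g₁ * a₃ + (4 : ℝ) / 3 * a₃ * g₃ + (56 : ℝ) / 5 * a₁ * a₂ * a₃ + (52 : ℝ) / 15 * a₁ * c₂ * c₃))
          + (((628 : ℝ) / 75 * a₁ * b₃ * c₂ + (156 : ℝ) / 25 * a₁ * b₂ * c₃ + (1 : ℝ) * g₁ * a₁ * c₃ + (28 : ℝ) / 5 * a₂ * c₁ * c₃)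
          + ((538 : ℝ) / 75 * a₂ * b₃ * c₁ + (4 : ℝ) / 3 * a₃ * c₁ * c₂ + (126 : ℝ) / 25 * a₃ * b₂ * c₁ + (56 : ℝ) / 15 * b₂ * b₃ * c₁))))
          + ((((1 : ℝ) * g₂ * b₂ * c₁ + (1 : ℝ) * g₁ * a₃ * c₁ + (1 : ℝ) * g₂ * b₃ * c₁ + (538 : ℝ) / 75 * a₂ * b₁ * c₃)
          + (((156 : ℝ) / 25 * a₃ * b₁ * c₂ + (92 : ℝ) / 15 * b₁ * b₃ * c₂ + (74 : ℝ) / 15 * b₁ * b₂ * c₃ + (136 : ℝ) / 25 * b₁ * b₂ * b₃)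
          + ((1 : ℝ) / 2 * g₁ * b₁ * b₂ + (1 : ℝ) * g₂ * b₁ * c₃ + (1 : ℝ) / 2 * g₁ * b₁ * b₃ + (1 : ℝ) * g₁ * a₃ * c₂)))
          + ((((1 : ℝ) / 2 * g₁ * b₂ * b₃ + (3 : ℝ) / 2 * g₁ * a₁ * a₂ * a₃ + (7 : ℝ) / 2 * g₁ * a₁ * c₂ * c₃ + (23 : ℝ) / 10 * g₁ * a₁ * b₃ * c₂)
          + ((13 : ℝ) / 10 * g₁ * a₁ * b₂ * c₃ + (9 : ℝ) / 2 * g₁ * a₂ * c₁ * c₃ + (33 : ℝ) / 10 * g₁ * a₂ * b₃ * c₁ + (5 : ℝ) / 2 * g₁ * a₃ * c₁ * c₂))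
          + (((23 : ℝ) / 10 * g₁ * a₃ * b₂ * c₁ + (11 : ℝ) / 2 * g₁ * b₂ * b₃ * c₁ + (33 : ℝ) / 10 * g₁ * a₂ * b₁ * c₃ + (13 : ℝ) / 10 * g₁ * a₃ * b₁ * c₂)
          + ((7 : ℝ) / 2 * g₁ * b₁ * b₃ * c₂ + (9 : ℝ) / 2 * g₁ * b₁ * b₂ * c₃ + (3 : ℝ) / 10 * g₁ * b₁ * b₂ * b₃))))) := by
      positivity
    subst e₁ e₂ e₃ e₄ e₅ e₆
    convert hpos using 1
    ring
  exact main _ _ _ _ _ _ hb₁ hb₂ hb₃ (sub_nonneg.mpr hTlo) (sub_nonneg.mpr hTup) (sub_nonneg.mpr hTs) rfl rfl rfl rfl rfl rfl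

set_option maxHeartbeats 4000000 in
set_option maxRecDepth 4096 in
/-- **regime `24/5 ≤ T ≤ 6`, joint torque cost `U + 2V ≤ R′` (linearised, `T − 3 ≥ 9/5`): `T·f₁ − (6−T)f₅ + 2T·f₂ ≤ (9/5)T·f₃ + 2T·f₄`** — for every triple of laws `(aᵢ, bᵢ, cᵢ)` on `{0,1,2}` with `T ≤ s = Σ(bᵢ + 2cᵢ)`.  Exact Handelman certificate of
degree 4 (185 products of the generators `aᵢ, bᵢ, cᵢ, T − 24 / 5, 6 − T, s − T`; kit j276081): the sign by `positivity` on
abstract nonnegative generators, the identity by `ring`. [this work] -/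
theorem tcIneq_costUWhilin (a₁ c₁ a₂ c₂ a₃ c₃ T : ℝ) (ha₁ : 0 ≤ a₁) (hc₁ : 0 ≤ c₁) (hb₁ : 0 ≤ 1 - a₁ - c₁) (ha₂ : 0 ≤ a₂) (hc₂ : 0 ≤ c₂)
    (hb₂ : 0 ≤ 1 - a₂ - c₂) (ha₃ : 0 ≤ a₃) (hc₃ : 0 ≤ c₃) (hb₃ : 0 ≤ 1 - a₃ - c₃)
    (hTlo : (24 / 5 : ℝ) ≤ T) (hTup : T ≤ 6) (hTs : T ≤ 1 - a₁ + c₁ + (1 - a₂ + c₂) + (1 - a₃ + c₃)) :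
    0 ≤ 9 / 5 * T * tA3[a₁, (1 - a₁ - c₁), c₁, a₂, (1 - a₂ - c₂), c₂, a₃, (1 - a₃ - c₃), c₃] + 2 * T * tA4[a₁, (1 - a₁ - c₁), c₁, a₂, (1 - a₂ - c₂), c₂, a₃, (1 - a₃ - c₃), c₃] + (6 - T) * tA5[(1 - a₁ - c₁), c₁, (1 - a₂ - c₂), c₂, (1 - a₃ - c₃), c₃] - T * tA1[a₁, (1 - a₁ - c₁), a₂, (1 - a₂ - c₂), a₃, (1 - a₃ - c₃)] - 2 * T * tA2[a₁, (1 - a₁ - c₁), c₁, a₂, (1 - a₂ - c₂), c₂, a₃, (1 - a₃ - c₃), c₃] := by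
  have main : ∀ (b₁ b₂ b₃ g₁ g₂ g₃ : ℝ), 0 ≤ b₁ → 0 ≤ b₂ → 0 ≤ b₃ → 0 ≤ g₁ → 0 ≤ g₂ → 0 ≤ g₃ →
      b₁ = 1 - a₁ - c₁ → b₂ = 1 - a₂ - c₂ → b₃ = 1 - a₃ - c₃ → g₁ = T - 24 / 5 → g₂ = 6 - T →
      g₃ = 1 - a₁ + c₁ + (1 - a₂ + c₂) + (1 - a₃ + c₃) - T →
      0 ≤ 9 / 5 * T * tA3[a₁, (1 - a₁ - c₁), c₁, a₂, (1 - a₂ - c₂), c₂, a₃, (1 - a₃ - c₃), c₃] + 2 * T * tA4[a₁, (1 - a₁ - c₁), c₁, a₂, (1 - a₂ - c₂), c₂, a₃, (1 - a₃ - c₃), c₃] + (6 - T) * tA5[(1 - a₁ - c₁), c₁, (1 - a₂ - c₂), c₂, (1 - a₃ - c₃), c₃] - T * tA1[a₁, (1 - a₁ - c₁), a₂, (1 - a₂ - c₂), a₃, (1 - a₃ - c₃)] - 2 * T * tA2[a₁, (1 - a₁ - c₁), c₁, a₂, (1 - a₂ - c₂), c₂, a₃, (1 - a₃ - c₃), c₃]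 := by
    intro b₁ b₂ b₃ g₁ g₂ g₃ hb₁' hb₂' hb₃' hg₁ hg₂ hg₃ e₁ e₂ e₃ e₄ e₅ e₆
    have hpos : 0 ≤ (((((((183 : ℝ) / 40 * a₁ ^ 2 + (269 : ℝ) / 160 * a₁ * b₁ + (343 : ℝ) / 128 * g₁ * a₁ + (1029 : ℝ) / 320 * a₁ * g₃)
          + ((183 : ℝ) / 40 * a₂ ^ 2 + (269 : ℝ) / 160 * a₂ * b₂ + (343 : ℝ) / 128 * g₁ * a₂ + (1029 : ℝ) / 320 * a₂ * g₃))
          + (((183 : ℝ) / 40 * a₃ ^ 2 + (269 : ℝ) / 160 * a₃ * b₃ + (343 : ℝ) / 128 * g₁ * a₃ + (1029 : ℝ) / 320 * a₃ * g₃)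
          + (((119 : ℝ) / 1280 * a₁ ^ 2 * b₁ + (297 : ℝ) / 320 * a₁ ^ 2 * c₂ + (297 : ℝ) / 320 * a₁ ^ 2 * c₃ + (119 : ℝ) / 2560 * a₁ * b₁ ^ 2)
          + ((1 : ℝ) / 320 * a₁ * b₁ * c₂ + (3577 : ℝ) / 2560 * a₁ * b₁ * b₂ + (107 : ℝ) / 640 * a₁ * b₁ * c₃ + (3577 : ℝ) / 2560 * a₁ * b₁ * b₃))))
          + ((((119 : ℝ) / 2560 * a₁ * b₁ * g₃ + (1629 : ℝ) / 50 * a₁ * a₂ * a₃ + (7203 : ℝ) / 640 * a₁ * a₂ * b₃ + (93 : ℝ) / 256 * a₁ * b₂ * c₂)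
          + (((69 : ℝ) / 400 * a₁ * c₂ * c₃ + (41217 : ℝ) / 6400 * a₁ * b₃ * c₂ + (7203 : ℝ) / 640 * a₁ * a₃ * b₂ + (42267 : ℝ) / 6400 * a₁ * b₂ * c₃)
          + ((93 : ℝ) / 256 * a₁ * b₃ * c₃ + (93 : ℝ) / 256 * a₂ * b₁ * c₁ + (93 : ℝ) / 256 * a₃ * b₁ * c₁ + (297 : ℝ) / 320 * a₂ ^ 2 * c₁)))
          + (((1 : ℝ) / 320 * a₂ * b₂ * c₁ + (69 : ℝ) / 400 * a₂ * c₁ * c₃ + (38823 : ℝ) / 6400 * a₂ * b₃ * c₁ + (69 : ℝ) / 400 * a₃ * c₁ * c₂)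
          + (((297 : ℝ) / 1280 * b₂ ^ 2 * c₁ + (38823 : ℝ) / 6400 * a₃ * b₂ * c₁ + (7449 : ℝ) / 1600 * b₂ * b₃ * c₁ + (287 : ℝ) / 640 * g₂ * b₂ * c₁)
          + ((297 : ℝ) / 320 * a₃ ^ 2 * c₁ + (1 : ℝ) / 320 * a₃ * b₃ * c₁ + (297 : ℝ) / 1280 * b₃ ^ 2 * c₁ + (287 : ℝ) / 640 * g₂ * b₃ * c₁)))))
          + (((((297 : ℝ) / 1280 * b₁ ^ 2 * c₂ + (297 : ℝ) / 1280 * b₁ ^ 2 * c₃ + (3577 : ℝ) / 2560 * a₂ * b₁ * b₂ + (7203 : ℝ) / 640 * a₂ * a₃ * b₁)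
          + (((37773 : ℝ) / 6400 * a₂ * b₁ * c₃ + (42267 : ℝ) / 6400 * a₃ * b₁ * c₂ + (9171 : ℝ) / 1600 * b₁ * b₃ * c₂ + (831 : ℝ) / 160 * b₁ * b₂ * c₃)
          + ((54819 : ℝ) / 3200 * b₁ * b₂ * b₃ + (891 : ℝ) / 1280 * b₁ * b₂ * g₃ + (3577 : ℝ) / 2560 * a₃ * b₁ * b₃ + (287 : ℝ) / 640 * g₂ * b₁ * c₃)))
          + (((891 : ℝ) / 1280 * b₁ * b₃ * g₃ + (21 : ℝ) / 1024 * g₂ * g₁ * b₁ + (49 : ℝ) / 2560 * g₂ * b₁ * g₃ + (119 : ℝ) / 1280 * a₂ ^ 2 * b₂)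
          + (((297 : ℝ) / 320 * a₂ ^ 2 * c₃ + (119 : ℝ) / 2560 * a₂ * b₂ ^ 2 + (1 : ℝ) / 320 * a₂ * b₂ * c₃ + (3577 : ℝ) / 2560 * a₂ * b₂ * b₃)
          + ((119 : ℝ) / 2560 * a₂ * b₂ * g₃ + (93 : ℝ) / 256 * a₂ * b₃ * c₃ + (93 : ℝ) / 256 * a₃ * b₂ * c₂ + (297 : ℝ) / 320 * a₃ ^ 2 * c₂))))
          + ((((107 : ℝ) / 640 * a₃ * b₃ * c₂ + (297 : ℝ) / 1280 * b₃ ^ 2 * c₂ + (297 : ℝ) / 1280 * b₂ ^ 2 * c₃ + (3577 : ℝ) / 2560 * a₃ * b₂ * b₃)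
          + (((891 : ℝ) / 1280 * b₂ * b₃ * g₃ + (21 : ℝ) / 1024 * g₂ * g₁ * b₂ + (49 : ℝ) / 2560 * g₂ * b₂ * g₃ + (119 : ℝ) / 1280 * a₃ ^ 2 * b₃)
          + ((119 : ℝ) / 2560 * a₃ * b₃ ^ 2 + (119 : ℝ) / 2560 * a₃ * b₃ * g₃ + (21 : ℝ) / 1024 * g₂ * g₁ * b₃ + (49 : ℝ) / 2560 * g₂ * b₃ * g₃)))
          + (((1467 : ℝ) / 640 * a₁ * b₁ * c₂ * c₃ + (21 : ℝ) / 128 * a₁ * b₁ * b₃ * c₂ + (7 : ℝ) / 512 * g₁ * a₁ * b₁ * b₂ + (7 : ℝ) / 512 * g₁ * a₁ * b₁ * b₃)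
          + (((7 : ℝ) / 1024 * g₂ ^ 2 * a₁ * b₁ + (1029 : ℝ) / 640 * g₁ * a₁ * a₂ * a₃ + (297 : ℝ) / 320 * a₁ * a₂ * c₃ * g₃ + (87 : ℝ) / 640 * a₁ * a₂ * b₃ * g₃)
          + ((891 : ℝ) / 320 * a₁ * c₂ ^ 2 * c₃ + (681 : ℝ) / 320 * a₁ * b₃ * c₂ ^ 2 + (1677 : ℝ) / 640 * a₁ * b₂ * c₂ * c₃ + (7 : ℝ) / 256 * g₁ * a₁ * b₂ * c₂))))))
          + ((((((297 : ℝ) / 320 * a₁ * a₃ * c₂ * g₃ + (891 : ℝ) / 320 * a₁ * c₂ * c₃ ^ 2 + (891 : ℝ) / 320 * a₁ * b₃ * c₂ * c₃ + (1623 : ℝ) / 640 * g₁ * a₁ * c₂ * c₃)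
          + (((21 : ℝ) / 128 * a₁ * b₃ ^ 2 * c₂ + (737 : ℝ) / 320 * g₁ * a₁ * b₃ * c₂ + (87 : ℝ) / 640 * a₁ * a₃ * b₂ * g₃ + (681 : ℝ) / 320 * a₁ * b₂ * c₃ ^ 2)
          + ((737 : ℝ) / 320 * g₁ * a₁ * b₂ * c₃ + (663 : ℝ) / 640 * a₁ * b₂ * b₃ * g₃ + (7 : ℝ) / 512 * g₂ * a₁ * b₂ * g₃ + (7 : ℝ) / 256 * g₁ * a₁ * b₃ * c₃)))
          + (((7 : ℝ) / 512 * g₂ * a₁ * b₃ * g₃ + (891 : ℝ) / 320 * a₂ * c₁ ^ 2 * c₃ + (681 : ℝ) / 320 * a₂ * b₃ * c₁ ^ 2 + (891 : ℝ) / 320 * a₃ * c₁ ^ 2 * c₂)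
          + (((681 : ℝ) / 320 * a₃ * b₂ * c₁ ^ 2 + (1257 : ℝ) / 320 * b₂ * b₃ * c₁ ^ 2 + (7 : ℝ) / 256 * g₂ * b₂ * c₁ ^ 2 + (7 : ℝ) / 256 * g₂ * b₃ * c₁ ^ 2)
          + ((891 : ℝ) / 320 * a₂ * b₁ * c₁ * c₃ + (7 : ℝ) / 256 * g₁ * a₂ * b₁ * c₁ + (1677 : ℝ) / 640 * a₃ * b₁ * c₁ * c₂ + (7 : ℝ) / 256 * g₁ * a₃ * b₁ * c₁))))
          + ((((7 : ℝ) / 1024 * g₂ * g₁ * b₁ * c₁ + (393 : ℝ) / 160 * a₂ * b₂ * c₁ * c₃ + (21 : ℝ) / 128 * a₂ * b₂ * b₃ * c₁ + (297 : ℝ) / 320 * a₂ * a₃ * c₁ * g₃)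
          + (((891 : ℝ) / 320 * a₂ * c₁ * c₃ ^ 2 + (1677 : ℝ) / 640 * a₂ * b₃ * c₁ * c₃ + (1623 : ℝ) / 640 * g₁ * a₂ * c₁ * c₃ + (1761 : ℝ) / 640 * g₁ * a₂ * b₃ * c₁)
          + ((891 : ℝ) / 320 * a₃ * c₁ * c₂ ^ 2 + (1677 : ℝ) / 640 * a₃ * b₂ * c₁ * c₂ + (1467 : ℝ) / 640 * a₃ * b₃ * c₁ * c₂ + (1623 : ℝ) / 640 * g₁ * a₃ * c₁ * c₂)))
          + (((297 : ℝ) / 640 * b₃ * c₁ * c₂ * g₃ + (7 : ℝ) / 512 * g₂ * b₂ ^ 2 * c₁ + (21 : ℝ) / 128 * a₃ * b₂ * b₃ * c₁ + (1761 : ℝ) / 640 * g₁ * a₃ * b₂ * c₁)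
          + (((297 : ℝ) / 640 * b₂ * c₁ * c₃ * g₃ + (2317 : ℝ) / 640 * g₁ * b₂ * b₃ * c₁ + (7 : ℝ) / 512 * g₂ * b₃ ^ 2 * c₁ + (21 : ℝ) / 128 * a₂ * b₁ ^ 2 * c₃)
          + ((7 : ℝ) / 512 * g₂ * b₁ ^ 2 * c₂ + (21 : ℝ) / 256 * b₁ ^ 2 * b₂ * b₃ + (7 : ℝ) / 512 * g₂ * b₁ ^ 2 * c₃ + (21 : ℝ) / 128 * a₂ * b₁ * b₂ * c₃)))))
          + (((((7 : ℝ) / 512 * g₁ * a₂ * b₁ * b₂ + (87 : ℝ) / 640 * a₂ * a₃ * b₁ * g₃ + (681 : ℝ) / 320 * a₂ * b₁ * c₃ ^ 2 + (1761 : ℝ) / 640 * g₁ * a₂ * b₁ * c₃)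
          + (((663 : ℝ) / 640 * a₂ * b₁ * b₃ * g₃ + (7 : ℝ) / 512 * g₂ * a₂ * b₁ * g₃ + (681 : ℝ) / 320 * a₃ * b₁ * c₂ ^ 2 + (1257 : ℝ) / 320 * b₁ * b₃ * c₂ ^ 2)
          + ((7 : ℝ) / 256 * g₂ * b₁ * c₂ ^ 2 + (737 : ℝ) / 320 * g₁ * a₃ * b₁ * c₂ + (297 : ℝ) / 640 * b₁ * c₂ * c₃ * g₃ + (1743 : ℝ) / 640 * g₁ * b₁ * b₃ * c₂)))
          + (((21 : ℝ) / 256 * b₁ * b₂ ^ 2 * b₃ + (663 : ℝ) / 640 * a₃ * b₁ * b₂ * g₃ + (1257 : ℝ) / 320 * b₁ * b₂ * c₃ ^ 2 + (203 : ℝ) / 64 * g₁ * b₁ * b₂ * c₃)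
          + (((21 : ℝ) / 256 * b₁ * b₂ * b₃ ^ 2 + (16089 : ℝ) / 2560 * g₁ * b₁ * b₂ * b₃ + (3351 : ℝ) / 1280 * b₁ * b₂ * b₃ * g₃ + (7 : ℝ) / 512 * g₂ * b₁ * b₂ * g₃)
          + ((7 : ℝ) / 512 * g₁ * a₃ * b₁ * b₃ + (7 : ℝ) / 512 * g₂ * a₃ * b₁ * g₃ + (7 : ℝ) / 256 * g₂ * b₁ * c₃ ^ 2 + (7 : ℝ) / 512 * g₂ * b₁ * b₃ * g₃))))
          + ((((7 : ℝ) / 1024 * g₂ ^ 2 * g₁ * b₁ + (7 : ℝ) / 1024 * g₂ ^ 2 * b₁ * g₃ + (7 : ℝ) / 512 * g₁ * a₂ * b₂ * b₃ + (7 : ℝ) / 1024 * g₂ ^ 2 * a₂ * b₂)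
          + (((7 : ℝ) / 256 * g₁ * a₂ * b₃ * c₃ + (7 : ℝ) / 512 * g₂ * a₂ * b₃ * g₃ + (7 : ℝ) / 256 * g₂ * b₃ * c₂ ^ 2 + (7 : ℝ) / 256 * g₁ * a₃ * b₂ * c₂)
          + ((7 : ℝ) / 1024 * g₂ * g₁ * b₂ * c₂ + (7 : ℝ) / 512 * g₂ * b₃ ^ 2 * c₂ + (7 : ℝ) / 512 * g₂ * b₂ ^ 2 * c₃ + (7 : ℝ) / 512 * g₁ * a₃ * b₂ * b₃)))
          + (((7 : ℝ) / 512 * g₂ * a₃ * b₂ * g₃ + (7 : ℝ) / 256 * g₂ * b₂ * c₃ ^ 2 + (7 : ℝ) / 512 * g₂ * b₂ * b₃ * g₃ + (7 : ℝ) / 1024 * g₂ ^ 2 * g₁ * b₂)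
          + (((7 : ℝ) / 1024 * g₂ ^ 2 * b₂ * g₃ + (7 : ℝ) / 1024 * g₂ ^ 2 * a₃ * b₃ + (7 : ℝ) / 1024 * g₂ * g₁ * b₃ * c₃ + (7 : ℝ) / 1024 * g₂ ^ 2 * g₁ * b₃)
          + ((7 : ℝ) / 1024 * g₂ ^ 2 * b₃ * g₃))))))) := by
      positivity
    subst e₁ e₂ e₃ e₄ e₅ e₆
    convert hpos using 1
    ring
  exact main _ _ _ _ _ _ hb₁ hb₂ hb₃ (sub_nonneg.mpr hTlo) (sub_nonneg.mpr hTup) (sub_nonneg.mpr hTs) rfl rfl rfl rfl rfl rfl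

end LawDec
end Quant
end Summit.CriticalPhenomena.PercolationContinuityZ3.Theorems
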